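import Summits.CriticalPhenomena.CardyFormulaZ2.Theorems.CardyBondTriangularBondTriangularCardyCofillCore
import Summits.CriticalPhenomena.CardyFormulaZ2.Theorems.CardyBondTriangularBondTriangularCardyYellowOfCrudeChain
import Summits.CriticalPhenomena.CardyFormulaZ2.Theorems.CardyBondTriangularBondTriangularCardyYellowOfCrudeRuns
import HarnessLib

/-!
# Route CardyBondTriangular · crux `BondTriangularCardy` (stmt-CriticalPhenomena-4664), line `birth`,
# stub `stub_yellowCrossingOfCrude`: an open crude crossing of `Ω` gives a yellow crossing of the
# cofilled domain or a yellow corner arm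

The registered stub `stub_yellowCrossingOfCrude : Sig.stub_yellowCrossingOfCrude` of the line
`birth` (reshape v5, `…CardyCofillCore.lean`): the DETERMINISTIC core of the upper half of
Bollobás–Riordan's sandwich (19) (Percolation, CUP 2006, Ch. 7, Claims 19–20 p. 192) for critical
bond percolation on `𝕋` in the Chayes–Lei hexagon packaging, at a fixed mesh.

Proof (assembly of `…CardyYellowOfCrudeChain.lean` and `…CardyYellowOfCrudeRuns.lean`). The open
crude crossing of `Ω` at mesh `δ/√3` is packaged into a walk `Y` in the yellow graph of
`clOfBond ω` of non-blue hexagons with centres within `2δ` of `Ω`, from a hexagon `x₀` within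
`< 2δ` of `A₀` to a hexagon `y` within `< 2δ` of `A₂` (`yellowChain_of_crude`). If a hexagon `x`
of `Y` is within `ρ` of a corner `p_j`, then `x₀` or `y` is farther than `r` from `p_j` (one of
`A₀`, `A₂` is farther than `r + ρ + 2δ` from `p_j`), and `Y` joins `x` to both: a yellow corner
arm. Otherwise all hexagons of `Y` are `ρ`-far from the corners, `x₀`, `y` are outside `G` (the
`ρ`-far sites of `G` are farther than `2δ` from `A₀ ∪ A₂`) of classes `A₀`, `A₂` (`2δ < κ`), and
`crossing_of_farChain` extracts the yellow crossing of `G` from its stretch `0` to its stretch `2`.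

References: B. Bollobás, O. Riordan, *Percolation*, CUP 2006, Ch. 7, Claims 19–20 p. 192;
L. Chayes, H. K. Lei, Rev. Math. Phys. 19 (2007) §2.1–2.3.
-/

noncomputable section

namespace Summit.CriticalPhenomena.CardyFormulaZ2.Theorems.BondTriangularCardyLine

open Set Filter Topology Metric
open Literature.Probability.Percolation Literature.Probability.RandomPlanarGeometry
open Literature.Probability.RandomPlanarGeometry.MarkedDomain
open Literature.Probability.LatticeModels

/-- **Stub `stub_yellowCrossingOfCrude` (deterministic core of the upper half of (19)): an open
crude crossing of `Ω` gives a yellow crossing of the cofilled `G` from stretch `0` to stretch `2`,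
or a yellow corner arm.** See `Sig.stub_yellowCrossingOfCrude` for the statement; the proof is
the hexagon chain of the open bond path (`yellowChain_of_crude`), the corner case read off the two
ends of the chain, and the run/class combinatorics of `crossing_of_farChain` in the far case
(Bollobás–Riordan 2006, Ch. 7, Claims 19–20 p. 192, for bond-`𝕋` in the Chayes–Lei packaging). -/
theorem stub_yellowCrossingOfCrude : Sig.stub_yellowCrossingOfCrude := by
  intro R G δ ρ κ η r ω hδ hωE harcs hco hin hκ hρ h02 hsep hr hcrude
  classical
  have hη : 0 ≤ η := infDist_nonneg.trans (harcs 0 _ (G.markSite_mem_arc 0))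
  have hA0ne : (R.arc 0).Nonempty := ⟨_, R.pt_mem_arc_self 0⟩
  have hA2ne : (R.arc 2).Nonempty := ⟨_, R.pt_mem_arc_self 2⟩
  have hρ0 : 0 < ρ := by linarith
  -- the yellow hexagon chain of the crude crossing
  obtain ⟨x₀, y, Y, hx₀, hy, hY⟩ := yellowChain_of_crude R δ ω hδ hωE
    (fun a ha b hb => by have := h02 a ha b hb; linarith) hcrude
  by_cases hcorner : ∃ x ∈ Y.support, ∃ j : Fin 4, dist (triMeshPoint δ x) (R.pt j) < ρ
  · -- the corner case: a yellow arm about `p_j`, from `x` to the far end of the chain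
    obtain ⟨x, hx, j, hxj⟩ := hcorner
    left
    refine ⟨j, ?_⟩
    rcases hr j with h0 | h2
    · obtain ⟨a, ha, hda⟩ := (infDist_lt_iff hA0ne).1 hx₀
      have h1 : infDist (R.pt j) (R.arc 0) ≤ dist (R.pt j) a := infDist_le_dist_of_mem ha
      have h3 := dist_triangle (R.pt j) (triMeshPoint δ x₀) a
      refine ⟨x, x₀, ⟨(Y.takeUntil x hx).reverse⟩, by rwa [← dist_eq_norm], ?_⟩
      rw [← dist_eq_norm, dist_comm]
      linarith
    · obtain ⟨b, hb, hdb⟩ := (infDist_lt_iff hA2ne).1 hy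
      have h1 : infDist (R.pt j) (R.arc 2) ≤ dist (R.pt j) b := infDist_le_dist_of_mem hb
      have h3 := dist_triangle (R.pt j) (triMeshPoint δ y) b
      refine ⟨x, y, ⟨Y.dropUntil x hx⟩, by rwa [← dist_eq_norm], ?_⟩
      rw [← dist_eq_norm, dist_comm]
      linarith
  · -- the far case: the ends of the chain are outside `G`, of classes `A₀` and `A₂`
    push Not at hcorner
    right
    have hx₀G : x₀ ∉ G.verts := fun h => by
      have := (hin x₀ h (hcorner x₀ (SimpleGraph.Walk.start_mem_support _))).1
      linarith
    have hyG : y ∉ G.verts := fun h => by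
      have := (hin y h (hcorner y (SimpleGraph.Walk.end_mem_support _))).2
      linarith
    exact crossing_of_farChain R hδ harcs hco hκ hρ h02 hsep Y.length Y le_rfl
      (fun z hz => ⟨(hY z hz).1, (hY z hz).2, hcorner z hz⟩) hx₀G (by linarith) hyG (by linarith)

end Summit.CriticalPhenomena.CardyFormulaZ2.Theorems.BondTriangularCardyLine

end
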